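import Mathlib
import HarnessLib
import Summits.HubbardSuperconductivity.HubbardSuperconductivity.Theorems.KLProgrammeKLRegimeSplitPhValueExchangeShifts

/-!
# Route `KLProgramme` — ENGINE (stmt-HubbardSuperconductivity-20437 `KLRegimeEngineV17F2`), row (c) binder #8 (★ v19 `hexLadMV`), the EXCHANGE p-h row `RQ` at the exchange diagonal
# `Qm = x + y`: REINDEXING both bubble orderings onto the hard line's label, the row is `Σ_p (Ẇ_tβL²ĝ)(p)·[(Φ_jβL²ĝ)(p⁺)·F p⁺ p + (Φ_jβL²ĝ)(p⁻)·F p p⁻]` (`p^± =` the label with the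
# Matsubara index moved by `±1`, same momentum) = ROTATION/MODULI object (O6c/O6e with the two partner values `F p⁺ p`, `F p p⁻`) + a ONE-MORE-RUNG correction carrying the
# thermal shift `q₀ = 2π/β` (O6d) and the member symbol's frequency modulus `εΦ` — brick O6h-b, the bound (structure half O6h-a = `…SplitPhValueExchangeShifts`)
# (cell gate-hubbard-kl, seat hubbard-kl-k3c2-p2 g32, technique «thermal-bar induction n ≤ nScales β + 1 with EngineBoundsAtV4S sums»)

WHY.  E1-LEDGER rev 13/14 line #8 books `RQ` as «the same spatial object with the partner frequency shifted by the pinned transfer: rotation part + a resolvent-identity correction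
`∝ (π/β)/Λ` = thermal».  O6g (`klph_exchangeRow_diag_eq`) wrote the rows door's `hQ` object at `Qm = x + y` as `Σ_p [p.1 ≠ bottom]((Φĝ)(p)(Ẇĝ)(p⁻) + (Ẇĝ)(p)(Φĝ)(p⁻))·F p p⁻`.
O6h-a supplies the up-shift `τ`, the reindexing `Σ_{p ≠ bottom} g(p, p⁻) = Σ_{q ≠ top} g(q⁺, q)` (so the HARD line `Ẇ` always sits at the summation label), the vanishing
of the hard line at the two boundary labels once `βΛ(t)/(2π) + 1 ≤ M`, and the abstract decomposition/correction bound.  Here: the decomposition `(Φĝ)(p^±) = (Φĝ)(p) + [(Φĝ)(p^±) − (Φĝ)(p)]` with `‖(Φĝ)(p^±) − (Φĝ)(p)‖ ≤ ‖ĝ(p)‖·(q₀‖ĝ(p^±)‖ + εΦ)`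
(O6d `klod_norm_propCT_sub_propCT_le`, `|Φ| ≤ 1`), against the hard line `|Ẇ|‖ĝ‖ ≤ (128/3)/Λ(t)²` and `‖ĝ‖ ≤ 2/Λ(t)` on the shell:

* **`klph_exchangeRow_diag_le_of_moduli`** — `(Λₙ−Λₙ₊₁)((βL²)³)⁻¹·‖hQ object‖ ≤ (Λₙ−Λₙ₊₁)·‖V₀ 0 + V₀ 1‖·𝔅₆_b(Λ(t)) + 2¹⁰·15367·δ
  + (Λₙ−Λₙ₊₁)·(N_sh/(βL²))·(512/3)·Λ(t)⁻³·F∞·(q₀·G₊ + εΦ)`, `q₀ = 2π/β`,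
  for data: `‖F p⁺ p − V₀ 0‖, ‖F p p⁻ − V₀ 1‖ ≤ δ`, `‖F p⁺ p‖, ‖F p p⁻‖ ≤ F∞`, `‖ĝ(p^±)‖ ≤ G₊`, `|Φ(p^±) − Φ(p)| ≤ εΦ` on the hard shell (`Ẇ_t(p) ≠ 0`), and
  `N_sh = #{p : Ẇ_t(p) ≠ 0}` (the consumer bounds it by `(βΛ(t)/π + 1)·#{k : |e_K| ≤ Λ(t)}`, `klzf_card_shell_le`; `G₊ ≤ 4√2/Λ(t)` above the thermal layer).
Pure finite-sum algebra + composition over landed rows; no definitions; nothing asserts (c), K3 or superconductivity.  [cite: BenfattoGiulianiMastropietro2006, §2.5]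
-/

noncomputable section

namespace Summit.HubbardSuperconductivity.HubbardSuperconductivity.Theorems.KLRegimeSplit

set_option linter.dupNamespace false -- summit = problem name (single-conjunct summit), D-0017

open Real Set Finset Literature.MathematicalPhysics.QuantumLattice
open Literature.Probability.LatticeModels hiding torusSupNorm
open Literature.MathematicalPhysics.QuantumLattice.BandSectorCounting
open Summit.HubbardSuperconductivity.HubbardSuperconductivity.Theorems.TwoPointAssembly
open Summit.HubbardSuperconductivity.HubbardSuperconductivity.Theorems.KLProgrammeLegKernels
open Summit.HubbardSuperconductivity.HubbardSuperconductivity.Theorems.KLRegimeWick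
open Summit.HubbardSuperconductivity.HubbardSuperconductivity.Theorems.EngineV8
open Summit.HubbardSuperconductivity.HubbardSuperconductivity.Theorems.DispersionFlow
open Summit.HubbardSuperconductivity.HubbardSuperconductivity.Theorems.PerturbedFermiCurve

variable {L M : ℕ} [NeZero L] [NeZero M]

/-! ## The exchange row at its diagonal: rotation + moduli + one-more-rung correction -/

section Bound

variable {R : RenConsts} {U : ℝ} {N : ℕ}

omit [NeZero L] [NeZero M] in
/-- On the hard shell (`Ẇ_Λ(p) ≠ 0`): `Λ²/4 ≤ ω_p² + e_p²`, hence `‖ĝ_K(p)‖ ≤ 2/Λ`. -/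
theorem klph_norm_propCT_le_of_derivWeight_ne_zero (β μ : ℝ) (K : TrigPolyC4v) {Λ : ℝ} (hΛ : 0 < Λ) {p : FreqMomentum L M}
    (hp : deriv (fun Λ' : ℝ => hubbardCutoffWeightCT L M β μ K Λ' p) Λ ≠ 0) : ‖propCT L M β μ K p‖ ≤ 2 / Λ := by
  have hs : Λ ^ 2 / 4 ≤ matsubaraFreq β M p.1 ^ 2 + nambuXiCT L μ K p.2 ^ 2 := by
    by_contra h
    exact hp (klws_deriv_cutoffWeight_scale_eq_zero L M β μ K hΛ.ne' p (Or.inl (lt_of_not_ge h)))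
  rw [norm_propCT_eq]
  have hsqrt : Λ / 2 ≤ Real.sqrt (matsubaraFreq β M p.1 ^ 2 + nambuXiCT L μ K p.2 ^ 2) := by
    rw [show Λ / 2 = Real.sqrt ((Λ / 2) ^ 2) from (Real.sqrt_sq (by positivity)).symm]
    exact Real.sqrt_le_sqrt (by linarith)
  calc (Real.sqrt (matsubaraFreq β M p.1 ^ 2 + nambuXiCT L μ K p.2 ^ 2))⁻¹ ≤ (Λ / 2)⁻¹ := inv_anti₀ (by positivity) hsqrt
    _ = 2 / Λ := by rw [inv_div]

/-- **THE EXCHANGE p-h ROW AT ITS DIAGONAL (`Qm = x + y`), ROTATION + MODULI + ONE-MORE-RUNG CORRECTION.**  Under the C4a chart hypotheses (rotation part), an admissible frame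
`FrameOK R U N μ K`, `klBetaMin ≤ β ≤ L`, member `j ≥ n+1`, `t ∈ [0,1]`, `βΛ(t)/(2π) + 1 ≤ M`, shifts `σ` (down) / `τ` (up) with their label laws, and DATA on the hard shell
(`Ẇ_t(p) ≠ 0`): `‖F p⁺ p − V₀ 0‖, ‖F p p⁻ − V₀ 1‖ ≤ δ`, `‖F p⁺ p‖, ‖F p p⁻‖ ≤ F∞`, `‖ĝ(p⁺)‖, ‖ĝ(p⁻)‖ ≤ G₊`, `|Φ_j(t)(p⁺) − Φ_j(t)(p)|, |Φ_j(t)(p⁻) − Φ_j(t)(p)| ≤ εΦ`: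
`(Λₙ−Λₙ₊₁)((βL²)³)⁻¹·‖hQ object‖ ≤ (Λₙ−Λₙ₊₁)·‖Σ_σV₀ σ‖·𝔅₆_b(Λ(t)) + 2¹⁰·15367·δ + (Λₙ−Λₙ₊₁)·N_sh·(βL²)⁻¹·((128/3)/Λ(t)²·(2·((2/Λ(t))·((2π/β)·G₊ + εΦ))·F∞))`,
`N_sh = #{p : Ẇ_t(p) ≠ 0}`. [cite: BenfattoGiulianiMastropietro2006, §2.5] -/
theorem klph_exchangeRow_diag_le_of_moduli {β μ : ℝ} {K : TrigPolyC4v} (hK : FrameOK R U N μ K) (hβ : klBetaMin ≤ β) (hβL : β ≤ L)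
    {a b : ℝ} (B : BandBounds a b) {A : ℝ} (hA : ∀ p : Momentum, ∀ j ≤ 2, ‖iteratedFDeriv ℝ j (frameShift K) p‖ ≤ A) (hADt : 2 * A < B.Dtmin)
    {r : ℝ} (hlo : a < μ - r - A) (hhi : μ + r + A < b) (n : ℕ) {t : ℝ} (ht : t ∈ Icc (0 : ℝ) 1)
    (Φ : ℕ → ℝ → FreqMomentum L M → ℝ) (hΦ : Φ = fun j t k => (softSymbolCompl L M β μ K (n + 1) j) k + (hubbardCutoffWeightCT L M β μ K (klScale klE0 (n + 1)) k -
            hubbardCutoffWeightCT L M β μ K (klScale klE0 n + t * (klScale klE0 (n + 1) - klScale klE0 n)) k))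
    (Wd : ℝ → FreqMomentum L M → ℝ) (hWd : Wd = fun t k => deriv (fun Λ' : ℝ => hubbardCutoffWeightCT L M β μ K Λ' k) (klScale klE0 n + t * (klScale klE0 (n + 1) - klScale klE0 n)))
    {j : ℕ} (hj : n + 1 ≤ j) (hΛr : klScale klE0 n + t * (klScale klE0 (n + 1) - klScale klE0 n) < r)
    (hM : β * (klScale klE0 n + t * (klScale klE0 (n + 1) - klScale klE0 n)) / (2 * Real.pi) + 1 ≤ M)
    {Mg ℓ r₁ : ℝ} (hr₁ : 0 < r₁)
    (hbd : ∀ s, |klWd (klScale klE0 n + t * (klScale klE0 (n + 1) - klScale klE0 n)) s *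
      klPhi (klScale klE0 j) (klScale klE0 n + t * (klScale klE0 (n + 1) - klScale klE0 n)) s| ≤ Mg)
    (hlip : ∀ s s', |klWd (klScale klE0 n + t * (klScale klE0 (n + 1) - klScale klE0 n)) s *
        klPhi (klScale klE0 j) (klScale klE0 n + t * (klScale klE0 (n + 1) - klScale klE0 n)) s -
      klWd (klScale klE0 n + t * (klScale klE0 (n + 1) - klScale klE0 n)) s' *
        klPhi (klScale klE0 j) (klScale klE0 n + t * (klScale klE0 (n + 1) - klScale klE0 n)) s'| ≤ ℓ * |s - s'|)
    (hin : ∀ s, s ≤ r₁ ^ 2 → klWd (klScale klE0 n + t * (klScale klE0 (n + 1) - klScale klE0 n)) s *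
      klPhi (klScale klE0 j) (klScale klE0 n + t * (klScale klE0 (n + 1) - klScale klE0 n)) s = 0)
    (hout : ∀ s, (klScale klE0 n + t * (klScale klE0 (n + 1) - klScale klE0 n)) ^ 2 ≤ s →
      klWd (klScale klE0 n + t * (klScale klE0 (n + 1) - klScale klE0 n)) s *
        klPhi (klScale klE0 j) (klScale klE0 n + t * (klScale klE0 (n + 1) - klScale klE0 n)) s = 0)
    {σ τ : MatsubaraIdx M → MatsubaraIdx M}
    (hσ : ∀ ν : MatsubaraIdx M, (ν : ℕ) ≠ 0 → matsubaraInt M (σ ν) = matsubaraInt M ν - 1) (hσ0 : ∀ ν : MatsubaraIdx M, (ν : ℕ) = 0 → σ ν = ν)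
    (hτ : ∀ ν : MatsubaraIdx M, (ν : ℕ) ≠ 2 * M - 1 → matsubaraInt M (τ ν) = matsubaraInt M ν + 1) (hτ0 : ∀ ν : MatsubaraIdx M, (ν : ℕ) = 2 * M - 1 → τ ν = ν)
    (F : FreqMomentum L M → FreqMomentum L M → ℂ) (V₀ : Fin 2 → ℂ) {δ Finf Gp εΦ : ℝ} (hδ0 : 0 ≤ δ) (hF0 : 0 ≤ Finf) (hG0 : 0 ≤ Gp) (hε0 : 0 ≤ εΦ)
    (hδ : ∀ p : FreqMomentum L M, Wd t p ≠ 0 → ‖F (τ p.1, p.2) p - V₀ 0‖ ≤ δ ∧ ‖F p (σ p.1, p.2) - V₀ 1‖ ≤ δ)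
    (hF : ∀ p : FreqMomentum L M, Wd t p ≠ 0 → ‖F (τ p.1, p.2) p‖ ≤ Finf ∧ ‖F p (σ p.1, p.2)‖ ≤ Finf)
    (hG : ∀ p : FreqMomentum L M, Wd t p ≠ 0 → ‖propCT L M β μ K (τ p.1, p.2)‖ ≤ Gp ∧ ‖propCT L M β μ K (σ p.1, p.2)‖ ≤ Gp)
    (hε : ∀ p : FreqMomentum L M, Wd t p ≠ 0 → |Φ j t (τ p.1, p.2) - Φ j t p| ≤ εΦ ∧ |Φ j t (σ p.1, p.2) - Φ j t p| ≤ εΦ)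
    {Qm x y : TorusSite 2 L} (hxy : Qm = x + y) :
    (klScale klE0 n - klScale klE0 (n + 1)) * ((β * (L : ℝ) ^ 2) ^ 3)⁻¹ *
      ‖∑ p : FreqMomentum L M, ∑ p' : FreqMomentum L M,
        (if matsubaraInt M p'.1 + matsubaraInt M (omega0 M) + matsubaraInt M (omega0 M) + 1 = matsubaraInt M p.1 ∧ p'.2 = p.2 + Qm - x - y then
          (((((Φ j t p) : ℝ) : ℂ) * (((β * (L : ℝ) ^ 2 : ℝ) : ℂ) * propCT L M β μ K p)) * ((((Wd t p') : ℝ) : ℂ) * (((β * (L : ℝ) ^ 2 : ℝ) : ℂ) * propCT L M β μ K p')) +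
            ((((Wd t p) : ℝ) : ℂ) * (((β * (L : ℝ) ^ 2 : ℝ) : ℂ) * propCT L M β μ K p)) * ((((Φ j t p') : ℝ) : ℂ) * (((β * (L : ℝ) ^ 2 : ℝ) : ℂ) * propCT L M β μ K p'))) *
            F p p'
        else 0)‖ ≤
      (klScale klE0 n - klScale klE0 (n + 1)) * ‖∑ σ : Fin 2, V₀ σ‖ *
        (((2 * π) ^ 2)⁻¹ * (2 * π * (π * Real.sqrt 2 / (B.Dtmin - 2 * A)) *
              ((2 * (klScale klE0 n + t * (klScale klE0 (n + 1) - klScale klE0 n)) * (2 * (klScale klE0 n + t * (klScale klE0 (n + 1) - klScale klE0 n)) *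
                (2 * (klScale klE0 n + t * (klScale klE0 (n + 1) - klScale klE0 n)) ^ 2 * (ℓ / r₁ ^ 4 + 2 * Mg / r₁ ^ 6) + (ℓ / r₁ ^ 2 + Mg / r₁ ^ 4)))) *
                ((klScale klE0 n + t * (klScale klE0 (n + 1) - klScale klE0 n)) + 2 * Real.pi / β) / β) +
            β⁻¹ * (((klScale klE0 n + t * (klScale klE0 (n + 1) - klScale klE0 n)) * β / π + 1) *
              (2 * (klScale klE0 n + t * (klScale klE0 (n + 1) - klScale klE0 n)) *
                (2 * π * (1 / (B.Dtmin - 2 * A) ^ 2 + Real.pi * Real.sqrt 2 * (2 + 4 * A) / (B.Dtmin - 2 * A) ^ 3) *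
                  (klScale klE0 n + t * (klScale klE0 (n + 1) - klScale klE0 n)) * (Mg / r₁ ^ 2))))) +
          ((klScale klE0 n + t * (klScale klE0 (n + 1) - klScale klE0 n)) / π + 3 / β) *
            (2 * π * (2 * (klScale klE0 n + t * (klScale klE0 (n + 1) - klScale klE0 n)) *
              (2 * (klScale klE0 n + t * (klScale klE0 (n + 1) - klScale klE0 n)) ^ 2 * (ℓ / r₁ ^ 4 + 2 * Mg / r₁ ^ 6) + (ℓ / r₁ ^ 2 + Mg / r₁ ^ 4)) *
              (4 + 2 * A)) / L)) +
        (2 : ℝ) ^ 10 * 15367 * δ +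
        (klScale klE0 n - klScale klE0 (n + 1)) * ((univ.filter fun p : FreqMomentum L M => Wd t p ≠ 0).card : ℝ) * (β * (L : ℝ) ^ 2)⁻¹ *
          ((128 / 3 / (klScale klE0 n + t * (klScale klE0 (n + 1) - klScale klE0 n)) ^ 2) *
            (2 * ((2 / (klScale klE0 n + t * (klScale klE0 (n + 1) - klScale klE0 n))) * ((2 * π / β) * Gp + εΦ)) * Finf)) := by
  classical
  have hβ0 : 0 < β := pos_of_klBetaMin_le hβ
  have hL : (0 : ℝ) < L := hβ0.trans_le hβL
  have hβL2 : 0 < β * (L : ℝ) ^ 2 := by positivity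
  have h10 := (klmf_klScale_succ_pos_le n).2
  have h1 := (klmf_klScale_succ_pos_le n).1
  have hmem := klws_affine_mem_Icc h10 ht
  set Λt : ℝ := klScale klE0 n + t * (klScale klE0 (n + 1) - klScale klE0 n) with hΛt_def
  have hΛt : 0 < Λt := h1.trans_le hmem.1
  have hdiff : 0 ≤ klScale klE0 n - klScale klE0 (n + 1) := by linarith
  have hC : 0 ≤ (klScale klE0 n - klScale klE0 (n + 1)) * ((β * (L : ℝ) ^ 2) ^ 3)⁻¹ := by positivity
  -- the two lines as functions of the label
  set hard : FreqMomentum L M → ℂ := fun p => (((Wd t p) : ℝ) : ℂ) * (((β * (L : ℝ) ^ 2 : ℝ) : ℂ) * propCT L M β μ K p) with hhard_def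
  set soft : FreqMomentum L M → ℂ := fun p => (((Φ j t p) : ℝ) : ℂ) * (((β * (L : ℝ) ^ 2 : ℝ) : ℂ) * propCT L M β μ K p) with hsoft_def
  -- the hard line vanishes at the boundary labels (and wherever `Ẇ = 0`)
  have hWd0 : ∀ p : FreqMomentum L M, (p.1 : ℕ) = 0 ∨ (p.1 : ℕ) = 2 * M - 1 → Wd t p = 0 := by
    intro p hp
    rw [hWd]
    exact klph_derivWeight_eq_zero_of_boundary (L := L) hβ0 μ K hΛt hM hp p.2
  have hbot : ∀ p : FreqMomentum L M, (p.1 : ℕ) = 0 → hard p = 0 := fun p hp => by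
    simp only [hhard_def, hWd0 p (Or.inl hp), Complex.ofReal_zero, zero_mul]
  have htop : ∀ p : FreqMomentum L M, (p.1 : ℕ) = 2 * M - 1 → hard p = 0 := fun p hp => by
    simp only [hhard_def, hWd0 p (Or.inr hp), Complex.ofReal_zero, zero_mul]
  have hhardWd : ∀ p : FreqMomentum L M, hard p ≠ 0 → Wd t p ≠ 0 := by
    intro p hp hW
    exact hp (by simp only [hhard_def, hW, Complex.ofReal_zero, zero_mul])
  -- Step 1: the object is the abstract shifted-pair sum
  have hobj := klph_exchangeRow_diag_eq (L := L) hσ β μ K (Φ j t) (Wd t) F hxy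
  have hdec := klph_exchange_decomp_abstract (L := L) hσ hτ hard soft F hbot htop
  -- Step 2: the main term is O6e's object with `W p s = ![F p⁺ p, F p p⁻] s`
  have hmain := klph_phValue_row_le_of_moduli (L := L) (M := M) hK hβ hβL B hA hADt hlo hhi n ht Φ hΦ Wd hWd hj hΛr hM hr₁ hbd hlip hin hout
    (fun p s => (![F (τ p.1, p.2) p, F p (σ p.1, p.2)] : Fin 2 → ℂ) s) V₀ hδ0 (fun p s hp => by
      fin_cases s
      · simpa using (hδ p hp).1
      · simpa using (hδ p hp).2)
  -- Step 3: the correction, sign-blind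
  have hΦ1 : ∀ k : FreqMomentum L M, |Φ j t k| ≤ 1 := by
    intro k
    have h := klmf_runningSymbol_mem L M β μ K n (isSoftSymbol_compl (L := L) (M := M) β μ K hj).1 ht k
    rw [hΦ]
    have hw : 0 ≤ hubbardCutoffWeightCT L M β μ K (klScale klE0 n) k := (salmhoferCutoff_mem_Icc _).1
    rw [abs_le]; constructor <;> linarith [h.1, h.2]
  have hH : ∀ p : FreqMomentum L M, hard p ≠ 0 → ‖hard p‖ ≤ β * (L : ℝ) ^ 2 * (128 / 3 / Λt ^ 2) := by
    intro p _
    have h : |Wd t p| * ‖propCT L M β μ K p‖ ≤ 128 / 3 / Λt ^ 2 := by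
      rw [hWd]; exact abs_derivWeight_mul_norm_propCT_le β μ K hΛt p
    have hn : ‖(((β * (L : ℝ) ^ 2 : ℝ) : ℂ))‖ = β * (L : ℝ) ^ 2 := by rw [Complex.norm_real, Real.norm_of_nonneg hβL2.le]
    have hp' : hard p = (((Wd t p) : ℝ) : ℂ) * (((β * (L : ℝ) ^ 2 : ℝ) : ℂ) * propCT L M β μ K p) := rfl
    rw [hp', norm_mul, norm_mul, hn, Complex.norm_real, Real.norm_eq_abs]
    calc |Wd t p| * (β * (L : ℝ) ^ 2 * ‖propCT L M β μ K p‖) = β * (L : ℝ) ^ 2 * (|Wd t p| * ‖propCT L M β μ K p‖) := by ring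
      _ ≤ β * (L : ℝ) ^ 2 * (128 / 3 / Λt ^ 2) := mul_le_mul_of_nonneg_left h hβL2.le
  -- the shifted soft line minus the unshifted one
  have hshift : ∀ (p : FreqMomentum L M) (ν' : MatsubaraIdx M), Wd t p ≠ 0 → |matsubaraFreq β M ν' - matsubaraFreq β M p.1| ≤ 2 * π / β →
      ‖propCT L M β μ K (ν', p.2)‖ ≤ Gp → |Φ j t (ν', p.2) - Φ j t p| ≤ εΦ →
      ‖soft (ν', p.2) - soft p‖ ≤ β * (L : ℝ) ^ 2 * ((2 / Λt) * ((2 * π / β) * Gp + εΦ)) := by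
    intro p ν' hp hω hg hφ
    have hgp : ‖propCT L M β μ K p‖ ≤ 2 / Λt := by
      rw [hWd] at hp
      exact klph_norm_propCT_le_of_derivWeight_ne_zero (L := L) β μ K hΛt hp
    have hres : ‖propCT L M β μ K (ν', p.2) - propCT L M β μ K p‖ ≤ (2 * π / β) * ‖propCT L M β μ K p‖ * Gp := by
      have h := klod_norm_propCT_sub_propCT_le μ K hβ0.ne' p.1 ν' p.2
      calc ‖propCT L M β μ K (ν', p.2) - propCT L M β μ K p‖ = ‖propCT L M β μ K (ν', p.2) - propCT L M β μ K (p.1, p.2)‖ := rfl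
        _ ≤ |matsubaraFreq β M ν' - matsubaraFreq β M p.1| * ‖propCT L M β μ K (p.1, p.2)‖ * ‖propCT L M β μ K (ν', p.2)‖ := h
        _ ≤ (2 * π / β) * ‖propCT L M β μ K p‖ * Gp := by
            have : ‖propCT L M β μ K (p.1, p.2)‖ = ‖propCT L M β μ K p‖ := rfl
            rw [this]
            exact mul_le_mul (mul_le_mul_of_nonneg_right hω (norm_nonneg _)) hg (norm_nonneg _) (by positivity)
    -- `Φ'ĝ' − Φĝ = Φ'(ĝ' − ĝ) + (Φ' − Φ)ĝ`
    have hsplit : soft (ν', p.2) - soft p = (((β * (L : ℝ) ^ 2 : ℝ) : ℂ)) *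
        ((((Φ j t (ν', p.2)) : ℝ) : ℂ) * (propCT L M β μ K (ν', p.2) - propCT L M β μ K p) +
          ((((Φ j t (ν', p.2) - Φ j t p : ℝ)) : ℂ)) * propCT L M β μ K p) := by
      simp only [hsoft_def]; push_cast; ring
    rw [hsplit, norm_mul, Complex.norm_real, Real.norm_of_nonneg hβL2.le]
    refine mul_le_mul_of_nonneg_left ?_ hβL2.le
    refine (norm_add_le _ _).trans ?_
    rw [norm_mul, norm_mul, Complex.norm_real, Complex.norm_real, Real.norm_eq_abs, Real.norm_eq_abs]
    have h1 : |Φ j t (ν', p.2)| * ‖propCT L M β μ K (ν', p.2) - propCT L M β μ K p‖ ≤ 1 * ((2 * π / β) * (2 / Λt) * Gp) := by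
      refine mul_le_mul (hΦ1 _) (hres.trans ?_) (norm_nonneg _) zero_le_one
      exact mul_le_mul_of_nonneg_right (mul_le_mul_of_nonneg_left hgp (by positivity)) hG0
    have h2 : |Φ j t (ν', p.2) - Φ j t p| * ‖propCT L M β μ K p‖ ≤ εΦ * (2 / Λt) := mul_le_mul hφ hgp (norm_nonneg _) hε0
    calc |Φ j t (ν', p.2)| * ‖propCT L M β μ K (ν', p.2) - propCT L M β μ K p‖ + |Φ j t (ν', p.2) - Φ j t p| * ‖propCT L M β μ K p‖
        ≤ 1 * ((2 * π / β) * (2 / Λt) * Gp) + εΦ * (2 / Λt) := add_le_add h1 h2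
      _ = (2 / Λt) * ((2 * π / β) * Gp + εΦ) := by ring
  have hE : ∀ p : FreqMomentum L M, hard p ≠ 0 →
      ‖soft (τ p.1, p.2) - soft p‖ ≤ β * (L : ℝ) ^ 2 * ((2 / Λt) * ((2 * π / β) * Gp + εΦ)) ∧
        ‖soft (σ p.1, p.2) - soft p‖ ≤ β * (L : ℝ) ^ 2 * ((2 / Λt) * ((2 * π / β) * Gp + εΦ)) := by
    intro p hp
    have hW := hhardWd p hp
    exact ⟨hshift p (τ p.1) hW (klph_abs_upShift_freq_sub_le hτ hβ0 hτ0 p.1) (hG p hW).1 (hε p hW).1,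
      hshift p (σ p.1) hW (klph_abs_shift_freq_sub_le hβ0 hσ hσ0 p.1) (hG p hW).2 (hε p hW).2⟩
  have hcorr := klph_exchange_corr_abstract_le (L := L) (σ := σ) (τ := τ) hard soft F (by positivity) (by positivity) hH hE
    (fun p hp => hF p (hhardWd p hp))
  -- the support of `hard` is the support of `Ẇ`
  have hcard : ((univ.filter fun p : FreqMomentum L M => hard p ≠ 0).card : ℝ) ≤ ((univ.filter fun p : FreqMomentum L M => Wd t p ≠ 0).card : ℝ) := by
    exact_mod_cast Finset.card_le_card (fun p hp => mem_filter.mpr ⟨mem_univ _, hhardWd p (mem_filter.mp hp).2⟩)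
  -- assemble
  rw [hobj]
  have hgoal : (∑ p : FreqMomentum L M, if (p.1 : ℕ) = 0 then 0 else
        (((((Φ j t p) : ℝ) : ℂ) * (((β * (L : ℝ) ^ 2 : ℝ) : ℂ) * propCT L M β μ K p)) *
              ((((Wd t (σ p.1, p.2)) : ℝ) : ℂ) * (((β * (L : ℝ) ^ 2 : ℝ) : ℂ) * propCT L M β μ K (σ p.1, p.2))) +
            ((((Wd t p) : ℝ) : ℂ) * (((β * (L : ℝ) ^ 2 : ℝ) : ℂ) * propCT L M β μ K p)) *
              ((((Φ j t (σ p.1, p.2)) : ℝ) : ℂ) * (((β * (L : ℝ) ^ 2 : ℝ) : ℂ) * propCT L M β μ K (σ p.1, p.2)))) *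
          F p (σ p.1, p.2)) =
      ∑ p : FreqMomentum L M, if (p.1 : ℕ) = 0 then 0 else (soft p * hard (σ p.1, p.2) + hard p * soft (σ p.1, p.2)) * F p (σ p.1, p.2) := by
    rfl
  rw [hgoal, hdec]
  set NW : ℝ := ((univ.filter fun p : FreqMomentum L M => Wd t p ≠ 0).card : ℝ) with hNW
  set X : ℝ := β * (L : ℝ) ^ 2 * (128 / 3 / Λt ^ 2) * (2 * (β * (L : ℝ) ^ 2 * ((2 / Λt) * ((2 * π / β) * Gp + εΦ))) * Finf) with hX
  have hX0 : 0 ≤ X := by positivity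
  have hcorr' : ‖∑ p : FreqMomentum L M, hard p * ((soft (τ p.1, p.2) - soft p) * F (τ p.1, p.2) p + (soft (σ p.1, p.2) - soft p) * F p (σ p.1, p.2))‖ ≤ NW * X :=
    hcorr.trans (mul_le_mul_of_nonneg_right hcard hX0)
  have hnorm : (klScale klE0 n - klScale klE0 (n + 1)) * ((β * (L : ℝ) ^ 2) ^ 3)⁻¹ * (NW * X) =
      (klScale klE0 n - klScale klE0 (n + 1)) * NW * (β * (L : ℝ) ^ 2)⁻¹ * ((128 / 3 / Λt ^ 2) * (2 * ((2 / Λt) * ((2 * π / β) * Gp + εΦ)) * Finf)) := by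
    rw [hX]; field_simp
  calc (klScale klE0 n - klScale klE0 (n + 1)) * ((β * (L : ℝ) ^ 2) ^ 3)⁻¹ *
        ‖(∑ p : FreqMomentum L M, ∑ s : Fin 2, hard p * soft p * (![F (τ p.1, p.2) p, F p (σ p.1, p.2)] : Fin 2 → ℂ) s) +
          ∑ p : FreqMomentum L M, hard p * ((soft (τ p.1, p.2) - soft p) * F (τ p.1, p.2) p + (soft (σ p.1, p.2) - soft p) * F p (σ p.1, p.2))‖
      ≤ (klScale klE0 n - klScale klE0 (n + 1)) * ((β * (L : ℝ) ^ 2) ^ 3)⁻¹ *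
          (‖∑ p : FreqMomentum L M, ∑ s : Fin 2, hard p * soft p * (![F (τ p.1, p.2) p, F p (σ p.1, p.2)] : Fin 2 → ℂ) s‖ + NW * X) :=
        mul_le_mul_of_nonneg_left ((norm_add_le _ _).trans (by linarith [hcorr'])) hC
    _ = (klScale klE0 n - klScale klE0 (n + 1)) * ((β * (L : ℝ) ^ 2) ^ 3)⁻¹ *
          ‖∑ p : FreqMomentum L M, ∑ s : Fin 2, hard p * soft p * (![F (τ p.1, p.2) p, F p (σ p.1, p.2)] : Fin 2 → ℂ) s‖ +
        (klScale klE0 n - klScale klE0 (n + 1)) * ((β * (L : ℝ) ^ 2) ^ 3)⁻¹ * (NW * X) := by ring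
    _ ≤ _ := by rw [hnorm]; exact add_le_add hmain le_rfl

end Bound

end Summit.HubbardSuperconductivity.HubbardSuperconductivity.Theorems.KLRegimeSplit

end
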